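import Literature.NumberTheory.Sieve.SmoothSaddlePoint
import Mathlib.NumberTheory.LSeries.Basic
import Mathlib.NumberTheory.EulerProduct.DirichletLSeries
import HarnessLib

/-!
# `ζ(s, y) = Π_{p ≤ y} (1 - p^{-s})⁻¹` at complex `s`: Dirichlet series and decay off the real axis

(Module docstring completed once the file is stable.)
-/

noncomputable section

open Complex Finset Real

namespace Literature.NumberTheory.Sieve

variable {σ t : ℝ} {y p : ℕ} {s : ℂ}

/-! ### The finite Euler product at complex `s` -/

/-- `ζ(s, y) = Π_{p ≤ y} (1 - p^{-s})⁻¹` for complex `s`, Hildebrand–Tenenbaum's `ζ(s, y)`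
("This finite part of the Euler product for the Riemann zeta function is meromorphic in `s` in the
whole plane. It never vanishes, and all its poles are located on the line `σ = 0`"); at a real point
it is the tree's `smoothZeta` (`smoothZetaC_ofReal`). [cite: HildebrandTenenbaum1986, §2 (definition of ζ(s, y))] -/
def smoothZetaC (s : ℂ) (y : ℕ) : ℂ :=
  ∏ p ∈ Nat.primesLE y, (1 - (p : ℂ) ^ (-s))⁻¹

/-- Unfolding lemma for `smoothZetaC`. [folklore] -/
theorem smoothZetaC_def (s : ℂ) (y : ℕ) :
    smoothZetaC s y = ∏ p ∈ Nat.primesLE y, (1 - (p : ℂ) ^ (-s))⁻¹ := rfl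

/-- Members of `primesLE y` are at least `2`. [folklore] -/
private theorem two_le_of_mem'' (hp : p ∈ Nat.primesLE y) : (2 : ℝ) ≤ p := by
  exact_mod_cast (Nat.mem_primesLE.1 hp).2.two_le

/-- At a real point, `ζ(σ, y)` is the tree's real Euler product `smoothZeta σ y`. [folklore] -/
theorem smoothZetaC_ofReal (σ : ℝ) (y : ℕ) : smoothZetaC σ y = (smoothZeta σ y : ℂ) := by
  rw [smoothZetaC, smoothZeta]
  push_cast
  refine Finset.prod_congr rfl fun p hp => ?_
  have hp0 : (0 : ℝ) ≤ p := Nat.cast_nonneg _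
  rw [show (p : ℂ) = ((p : ℝ) : ℂ) by simp, ← Complex.ofReal_neg,
    ← Complex.ofReal_cpow hp0 (-σ)]

/-- `‖p^{-s}‖ = p^{-Re s}` for `p ≥ 1`. [folklore] -/
theorem norm_natCast_cpow_neg (hp : 0 < p) (s : ℂ) : ‖(p : ℂ) ^ (-s)‖ = (p : ℝ) ^ (-s.re) := by
  rw [Complex.norm_natCast_cpow_of_pos hp]; simp

/-- The Euler factor: for `p ≥ 2` and `Re s > 0`, `‖p^{-s}‖ < 1`, so `1 - p^{-s} ≠ 0`. [folklore] -/
theorem one_sub_cpow_ne_zero (hp : 2 ≤ p) (hs : 0 < s.re) : 1 - (p : ℂ) ^ (-s) ≠ 0 := by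
  intro h
  have h1 : ‖(p : ℂ) ^ (-s)‖ = 1 := by rw [← sub_eq_zero.1 h]; simp
  rw [norm_natCast_cpow_neg (by omega) s] at h1
  have hp1 : (1 : ℝ) < p := by exact_mod_cast (lt_of_lt_of_le one_lt_two hp)
  have : (p : ℝ) ^ (-s.re) < 1 := Real.rpow_lt_one_of_one_lt_of_neg hp1 (by linarith)
  linarith

/-- `ζ(s, y) ≠ 0` ("It never vanishes"), for `Re s > 0`. [cite: HildebrandTenenbaum1986, §2] -/
theorem smoothZetaC_ne_zero (hs : 0 < s.re) (y : ℕ) : smoothZetaC s y ≠ 0 := by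
  rw [smoothZetaC]
  refine Finset.prod_ne_zero_iff.2 fun p hp => inv_ne_zero ?_
  exact one_sub_cpow_ne_zero (Nat.mem_primesLE.1 hp).2.two_le hs

/-! ### The size of an Euler factor off the real axis -/

/-- `p^{-(σ+it)} = p^{-σ} (cos(t log p) - i sin(t log p))` for `p ≥ 1`. [folklore] -/
theorem natCast_cpow_neg_add_mul_I (hp : 0 < p) (σ t : ℝ) :
    (p : ℂ) ^ (-((σ : ℂ) + t * I)) =
      (((p : ℝ) ^ (-σ) : ℝ) : ℂ) * (Real.cos (t * Real.log p) - Real.sin (t * Real.log p) * I) := by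
  have hp0 : (0 : ℝ) < p := by exact_mod_cast hp
  have hpC : (p : ℂ) ≠ 0 := by exact_mod_cast hp.ne'
  set φ : ℝ := t * Real.log p with hφ
  -- right-hand side as a product of exponentials
  have h1 : (((p : ℝ) ^ (-σ) : ℝ) : ℂ) = Complex.exp (((-σ * Real.log p : ℝ)) : ℂ) := by
    rw [Real.rpow_def_of_pos hp0, Complex.ofReal_exp]
    push_cast
    ring_nf
  have h2 : ((Real.cos φ : ℝ) : ℂ) - (Real.sin φ : ℝ) * I = Complex.exp (((-φ : ℝ) : ℂ) * I) := by
    rw [Complex.exp_mul_I, ← Complex.ofReal_cos, ← Complex.ofReal_sin, Real.cos_neg, Real.sin_neg]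
    push_cast
    ring
  rw [h1, h2, ← Complex.exp_add, Complex.cpow_def_of_ne_zero hpC,
    show (p : ℂ) = ((p : ℝ) : ℂ) by simp, (Complex.ofReal_log hp0.le).symm]
  congr 1
  rw [hφ]
  push_cast
  ring

/-- **The Euler factor off the real axis**: for `p ≥ 1`,
`‖1 - p^{-(σ+it)}‖² = (1 - p^{-σ})² + 2 p^{-σ} (1 - cos(t log p))`. [folklore] -/
theorem norm_sq_one_sub_cpow (hp : 0 < p) (σ t : ℝ) :
    ‖1 - (p : ℂ) ^ (-((σ : ℂ) + t * I))‖ ^ 2 =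
      (1 - (p : ℝ) ^ (-σ)) ^ 2 + 2 * (p : ℝ) ^ (-σ) * (1 - Real.cos (t * Real.log p)) := by
  rw [natCast_cpow_neg_add_mul_I hp σ t, Complex.sq_norm, Complex.normSq_apply]
  simp only [Complex.sub_re, Complex.one_re, Complex.mul_re, Complex.ofReal_re, Complex.ofReal_im,
    Complex.sub_im, Complex.one_im, Complex.mul_im, Complex.I_re, Complex.I_im]
  have hcs : Real.cos (t * Real.log p) ^ 2 + Real.sin (t * Real.log p) ^ 2 = 1 :=
    Real.cos_sq_add_sin_sq _
  linear_combination ((p : ℝ) ^ (-σ)) ^ 2 * hcs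

/-- `‖1 - p^{-(σ+it)}‖ ≥ 1 - p^{-σ}` (the factor is largest in size on the real axis). [folklore] -/
theorem one_sub_rpow_le_norm_one_sub_cpow (hp : 0 < p) (hσ : 0 ≤ σ) (t : ℝ) :
    1 - (p : ℝ) ^ (-σ) ≤ ‖1 - (p : ℂ) ^ (-((σ : ℂ) + t * I))‖ := by
  have hp1 : (1 : ℝ) ≤ p := by exact_mod_cast hp
  have hle1 : (p : ℝ) ^ (-σ) ≤ 1 := Real.rpow_le_one_of_one_le_of_nonpos hp1 (by linarith)
  have h0 : 0 ≤ 1 - (p : ℝ) ^ (-σ) := by linarith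
  have hsq := norm_sq_one_sub_cpow hp σ t
  have hcos : 0 ≤ 1 - Real.cos (t * Real.log p) := by linarith [Real.cos_le_one (t * Real.log p)]
  have hpσ : 0 ≤ (p : ℝ) ^ (-σ) := Real.rpow_nonneg (by linarith) _
  have h2 : (1 - (p : ℝ) ^ (-σ)) ^ 2 ≤ ‖1 - (p : ℂ) ^ (-((σ : ℂ) + t * I))‖ ^ 2 := by
    rw [hsq]; nlinarith
  exact (pow_le_pow_iff_left₀ h0 (norm_nonneg _) two_ne_zero).1 h2


/-- `‖ζ(σ + it, y)‖ ≤ ζ(σ, y)` for `σ > 0`. [cite: HildebrandTenenbaum1986, §3 Lemma 8 (i)] -/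
theorem norm_smoothZetaC_le (hσ : 0 < σ) (t : ℝ) (y : ℕ) :
    ‖smoothZetaC ((σ : ℂ) + t * I) y‖ ≤ smoothZeta σ y := by
  rw [smoothZetaC, smoothZeta, norm_prod]
  refine Finset.prod_le_prod (fun p _ => norm_nonneg _) fun p hp => ?_
  have hp2 := (Nat.mem_primesLE.1 hp).2.two_le
  have hp0 : 0 < p := by omega
  have hp1r : (1 : ℝ) < p := by exact_mod_cast (lt_of_lt_of_le one_lt_two hp2)
  have hlt : (p : ℝ) ^ (-σ) < 1 := Real.rpow_lt_one_of_one_lt_of_neg hp1r (by linarith)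
  rw [norm_inv]
  exact inv_anti₀ (by linarith) (one_sub_rpow_le_norm_one_sub_cpow hp0 hσ.le t)

/-- The oscillation weight `w_p = 2 p^{-σ} (1 - cos(t log p))/(1 - p^{-σ})²` of a prime, for which
`‖1 - p^{-(σ+it)}‖² = (1 - p^{-σ})² (1 + w_p)`. [folklore] -/
theorem norm_sq_one_sub_cpow_eq_mul (hp : 2 ≤ p) (hσ : 0 < σ) (t : ℝ) :
    ‖1 - (p : ℂ) ^ (-((σ : ℂ) + t * I))‖ ^ 2 =
      (1 - (p : ℝ) ^ (-σ)) ^ 2 *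
        (1 + 2 * (p : ℝ) ^ (-σ) * (1 - Real.cos (t * Real.log p)) / (1 - (p : ℝ) ^ (-σ)) ^ 2) := by
  have hp1r : (1 : ℝ) < p := by exact_mod_cast (lt_of_lt_of_le one_lt_two hp)
  have hlt : (p : ℝ) ^ (-σ) < 1 := Real.rpow_lt_one_of_one_lt_of_neg hp1r (by linarith)
  have hne : (1 - (p : ℝ) ^ (-σ)) ^ 2 ≠ 0 := by positivity
  rw [norm_sq_one_sub_cpow (by omega) σ t]
  rw [show (1 : ℝ) + 2 * (p : ℝ) ^ (-σ) * (1 - Real.cos (t * Real.log p)) / (1 - (p : ℝ) ^ (-σ)) ^ 2 =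
      ((1 - (p : ℝ) ^ (-σ)) ^ 2 + 2 * (p : ℝ) ^ (-σ) * (1 - Real.cos (t * Real.log p))) /
        (1 - (p : ℝ) ^ (-σ)) ^ 2 by rw [add_div, div_self hne],
    ← mul_div_assoc, mul_div_cancel_left₀ _ hne]

/-- **The Euler factor, per prime**: for `p^σ ≥ 3/2` (e.g. `σ ≥ 3/5`), with
`w_p = 2 p^{-σ}(1 - cos(t log p))/(1 - p^{-σ})² ≤ 24`,
`‖1 - p^{-(σ+it)}‖⁻¹ ≤ (1 - p^{-σ})⁻¹ exp(-w_p/50)` (`‖1 - p^{-s}‖² = (1 - p^{-σ})²(1 + w_p)` and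
`1 + w ≥ exp(w/25)` for `0 ≤ w ≤ 24`). [folklore] -/
theorem inv_norm_one_sub_cpow_le (hp : 2 ≤ p) (hσ : 3 / 5 ≤ σ) (t : ℝ) :
    ‖1 - (p : ℂ) ^ (-((σ : ℂ) + t * I))‖⁻¹ ≤ (1 - (p : ℝ) ^ (-σ))⁻¹ *
      Real.exp (-(1 / 50) * (2 * (p : ℝ) ^ (-σ) * (1 - Real.cos (t * Real.log p)) /
        (1 - (p : ℝ) ^ (-σ)) ^ 2)) := by
  have hσ0 : 0 < σ := by linarith
  have hp0 : 0 < p := by omega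
  have hp2r : (2 : ℝ) ≤ p := by exact_mod_cast hp
  have hp0r : (0 : ℝ) < p := by linarith
  set a : ℝ := (p : ℝ) ^ (-σ) with ha
  set c : ℝ := 1 - Real.cos (t * Real.log p) with hc
  -- `a = p^{-σ} ≤ 2/3`
  have ha23 : a ≤ 2 / 3 := by
    have hP : (3 / 2 : ℝ) ≤ (p : ℝ) ^ σ := by
      calc (3 / 2 : ℝ) ≤ (2 : ℝ) ^ (3 / 5 : ℝ) := by
            -- `2^{3/5} ≥ 3/2` as `(3/2)^5 ≤ 8`
            by_contra h
            push Not at h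
            have h0 : 0 ≤ (2 : ℝ) ^ (3 / 5 : ℝ) := by positivity
            have h5 : ((2 : ℝ) ^ (3 / 5 : ℝ)) ^ 5 < (3 / 2 : ℝ) ^ 5 := pow_lt_pow_left₀ h h0 (by norm_num)
            have heq : ((2 : ℝ) ^ (3 / 5 : ℝ)) ^ 5 = 8 := by
              rw [← Real.rpow_natCast, ← Real.rpow_mul (by norm_num : (0 : ℝ) ≤ 2),
                show (3 / 5 : ℝ) * ((5 : ℕ) : ℝ) = ((3 : ℕ) : ℝ) by norm_num, Real.rpow_natCast]
              norm_num
            rw [heq] at h5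
            norm_num at h5
        _ ≤ (2 : ℝ) ^ σ := Real.rpow_le_rpow_of_exponent_le one_le_two hσ
        _ ≤ (p : ℝ) ^ σ := Real.rpow_le_rpow (by norm_num) hp2r hσ0.le
    rw [ha, Real.rpow_neg hp0r.le]
    rw [inv_le_comm₀ (by positivity) (by norm_num)]
    linarith
  have ha0 : 0 < a := Real.rpow_pos_of_pos hp0r _
  have h1a : 1 / 3 ≤ 1 - a := by linarith
  have hc0 : 0 ≤ c := by rw [hc]; linarith [Real.cos_le_one (t * Real.log p)]
  have hc2 : c ≤ 2 := by rw [hc]; linarith [Real.neg_one_le_cos (t * Real.log p)]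
  -- the weight `w`
  set w : ℝ := 2 * a * c / (1 - a) ^ 2 with hw
  have hw0 : 0 ≤ w := by positivity
  have hw24 : w ≤ 24 := by
    rw [hw, div_le_iff₀ (by positivity)]
    nlinarith
  have hnorm_sq : ‖1 - (p : ℂ) ^ (-((σ : ℂ) + t * I))‖ ^ 2 = (1 - a) ^ 2 * (1 + w) := by
    rw [norm_sq_one_sub_cpow_eq_mul hp hσ0 t]
  have hlog : w / 25 ≤ Real.log (1 + w) := by
    calc w / 25 ≤ w / (1 + w) := div_le_div_of_nonneg_left hw0 (by positivity) (by linarith)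
      _ ≤ Real.log (1 + w) := by
          -- `log(1 + w) ≥ w/(1 + w)` from `log x ≤ x - 1` at `x = 1/(1+w)`
          have h1 : 0 < 1 + w := by linarith
          have h := Real.log_le_sub_one_of_pos (inv_pos.2 h1)
          rw [Real.log_inv] at h
          have : (1 + w)⁻¹ - 1 = -(w / (1 + w)) := by field_simp; ring
          linarith
  have hexp : Real.exp (w / 25) ≤ 1 + w := by
    calc Real.exp (w / 25) ≤ Real.exp (Real.log (1 + w)) := Real.exp_le_exp.2 hlog
      _ = 1 + w := Real.exp_log (by positivity)
  have hkey : (1 + w)⁻¹ ≤ Real.exp (2 * (-(1 / 50) * w)) := by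
    calc (1 + w)⁻¹ ≤ (Real.exp (w / 25))⁻¹ := inv_anti₀ (Real.exp_pos _) hexp
      _ = Real.exp (2 * (-(1 / 50) * w)) := by rw [← Real.exp_neg]; ring_nf
  have hgoal_sq : ‖1 - (p : ℂ) ^ (-((σ : ℂ) + t * I))‖⁻¹ ^ 2 ≤
      ((1 - a)⁻¹ * Real.exp (-(1 / 50) * w)) ^ 2 := by
    calc ‖1 - (p : ℂ) ^ (-((σ : ℂ) + t * I))‖⁻¹ ^ 2 = ((1 - a) ^ 2)⁻¹ * (1 + w)⁻¹ := by
          rw [inv_pow, hnorm_sq, mul_inv]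
      _ ≤ ((1 - a) ^ 2)⁻¹ * Real.exp (2 * (-(1 / 50) * w)) :=
          mul_le_mul_of_nonneg_left hkey (by positivity)
      _ = ((1 - a)⁻¹ * Real.exp (-(1 / 50) * w)) ^ 2 := by
          rw [mul_pow, inv_pow, ← Real.exp_nat_mul]
          push_cast
          ring_nf
  exact (pow_le_pow_iff_left₀ (by positivity) (by positivity) two_ne_zero).1 hgoal_sq

/-- **Decay of `ζ(s, y)` off the real axis (weight form)**: for `σ ≥ 3/5`,
`‖ζ(σ + it, y)‖ ≤ ζ(σ, y) · exp(-(1/50) Σ_{p ≤ y} w_p)`,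
`w_p = 2 p^{-σ}(1 - cos(t log p))/(1 - p^{-σ})²`. [cite: HildebrandTenenbaum1986, §3 Lemma 8] -/
theorem norm_smoothZetaC_le_mul_exp_weight (hσ : 3 / 5 ≤ σ) (t : ℝ) (y : ℕ) :
    ‖smoothZetaC ((σ : ℂ) + t * I) y‖ ≤ smoothZeta σ y *
      Real.exp (-(1 / 50) * ∑ p ∈ Nat.primesLE y,
        2 * (p : ℝ) ^ (-σ) * (1 - Real.cos (t * Real.log p)) / (1 - (p : ℝ) ^ (-σ)) ^ 2) := by
  rw [smoothZetaC, smoothZeta, norm_prod, Finset.mul_sum, Real.exp_sum, ← Finset.prod_mul_distrib]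
  refine Finset.prod_le_prod (fun p _ => norm_nonneg _) fun p hp => ?_
  rw [norm_inv]
  exact inv_norm_one_sub_cpow_le (Nat.mem_primesLE.1 hp).2.two_le hσ t

/-- **Decay of `ζ(s, y)` off the real axis**: for `σ ≥ 3/5`,
`‖ζ(σ + it, y)‖ ≤ ζ(σ, y) · exp(-(1/25) Σ_{p ≤ y} p^{-σ} (1 - cos(t log p)))`
(`w_p ≥ 2 p^{-σ}(1 - cos(t log p))`). [cite: HildebrandTenenbaum1986, §3 Lemma 8] -/
theorem norm_smoothZetaC_le_mul_exp (hσ : 3 / 5 ≤ σ) (t : ℝ) (y : ℕ) :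
    ‖smoothZetaC ((σ : ℂ) + t * I) y‖ ≤ smoothZeta σ y *
      Real.exp (-(1 / 25) * ∑ p ∈ Nat.primesLE y, (p : ℝ) ^ (-σ) * (1 - Real.cos (t * Real.log p))) := by
  have hσ0 : 0 < σ := by linarith
  refine le_trans (norm_smoothZetaC_le_mul_exp_weight hσ t y) ?_
  refine mul_le_mul_of_nonneg_left (Real.exp_le_exp.2 ?_) (smoothZeta_pos hσ0).le
  -- termwise `2 a c/(1-a)² ≥ 2 a c`
  have hsum : ∑ p ∈ Nat.primesLE y, (p : ℝ) ^ (-σ) * (1 - Real.cos (t * Real.log p)) * 2 ≤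
      ∑ p ∈ Nat.primesLE y,
        2 * (p : ℝ) ^ (-σ) * (1 - Real.cos (t * Real.log p)) / (1 - (p : ℝ) ^ (-σ)) ^ 2 := by
    refine Finset.sum_le_sum fun p hp => ?_
    have hp2 := (Nat.mem_primesLE.1 hp).2.two_le
    have hp1r : (1 : ℝ) < p := by exact_mod_cast (lt_of_lt_of_le one_lt_two hp2)
    have hp0r : (0 : ℝ) < p := by linarith
    have hlt : (p : ℝ) ^ (-σ) < 1 := Real.rpow_lt_one_of_one_lt_of_neg hp1r (by linarith)
    have ha0 : 0 ≤ (p : ℝ) ^ (-σ) := Real.rpow_nonneg hp0r.le _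
    have hc0 : 0 ≤ 1 - Real.cos (t * Real.log p) := by linarith [Real.cos_le_one (t * Real.log p)]
    rw [le_div_iff₀ (by nlinarith)]
    have h1 : (1 - (p : ℝ) ^ (-σ)) ^ 2 ≤ 1 := by nlinarith
    have h2 := mul_le_mul_of_nonneg_left h1
      (by positivity : 0 ≤ 2 * ((p : ℝ) ^ (-σ) * (1 - Real.cos (t * Real.log p))))
    nlinarith
  rw [← Finset.sum_mul] at hsum
  linarith

/-! ### Near the real axis: Gaussian decay governed by `φ₂` -/

/-- `1 - cos θ ≥ (2/π²) θ²` for `|θ| ≤ π` (`1 - cos θ = 2 sin²(θ/2)` and Jordan's inequality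
`sin(θ/2) ≥ θ/π` on `[0, π]`). [folklore] -/
theorem two_div_pi_sq_mul_sq_le_one_sub_cos {φ : ℝ} (hφ : |φ| ≤ Real.pi) :
    2 / Real.pi ^ 2 * φ ^ 2 ≤ 1 - Real.cos φ := by
  -- reduce to `φ ≥ 0` by evenness
  wlog h0 : 0 ≤ φ generalizing φ
  · have h := this (φ := -φ) (by rwa [abs_neg]) (by linarith [le_of_not_ge h0])
    rwa [neg_sq, Real.cos_neg] at h
  have hφπ : φ ≤ Real.pi := (le_abs_self φ).trans hφ
  have hhalf : 2 / Real.pi * (φ / 2) ≤ Real.sin (φ / 2) :=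
    Real.mul_le_sin (by linarith) (by linarith)
  have hcos : Real.cos φ = 1 - 2 * Real.sin (φ / 2) ^ 2 := by
    have h := Real.cos_two_mul (φ / 2)
    rw [show 2 * (φ / 2) = φ by ring] at h
    have hs := Real.sin_sq_add_cos_sq (φ / 2)
    linarith
  have hπ : 0 < Real.pi := Real.pi_pos
  have hj0 : 0 ≤ 2 / Real.pi * (φ / 2) := by positivity
  have hsq : (2 / Real.pi * (φ / 2)) ^ 2 ≤ Real.sin (φ / 2) ^ 2 :=
    pow_le_pow_left₀ hj0 hhalf 2
  have heq : (2 / Real.pi * (φ / 2)) ^ 2 = φ ^ 2 / Real.pi ^ 2 := by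
    field_simp
  rw [heq] at hsq
  rw [hcos, show 2 / Real.pi ^ 2 * φ ^ 2 = 2 * (φ ^ 2 / Real.pi ^ 2) by ring]
  linarith

/-- **Gaussian decay near the real axis**: for `σ ≥ 3/5` and `|t| log y ≤ π`,
`‖ζ(σ + it, y)‖ ≤ ζ(σ, y) · exp(-(2t²/(25π²)) Σ_{p ≤ y} log² p · p^σ/(p^σ - 1)²)`
`= ζ(σ, y) exp(-(2/(25π²)) t² φ₂(σ, y))` (each `|t log p| ≤ π`, so `1 - cos(t log p) ≥ (2/π²) t² log² p`,
and `p^{-σ}/(1 - p^{-σ})² = p^σ/(p^σ - 1)²`). [cite: HildebrandTenenbaum1986, §3 Lemma 8 (i)] -/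
theorem norm_smoothZetaC_le_mul_exp_gaussian (hσ : 3 / 5 ≤ σ)
    (ht : |t| * Real.log y ≤ Real.pi) :
    ‖smoothZetaC ((σ : ℂ) + t * I) y‖ ≤ smoothZeta σ y *
      Real.exp (-(2 / (25 * Real.pi ^ 2)) * t ^ 2 *
        ∑ p ∈ Nat.primesLE y, Real.log p ^ 2 * ((p : ℝ) ^ σ / ((p : ℝ) ^ σ - 1) ^ 2)) := by
  have hσ0 : 0 < σ := by linarith
  refine le_trans (norm_smoothZetaC_le_mul_exp_weight hσ t y) ?_
  refine mul_le_mul_of_nonneg_left (Real.exp_le_exp.2 ?_) (smoothZeta_pos hσ0).le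
  have h : 2 / (25 * Real.pi ^ 2) * t ^ 2 *
      ∑ p ∈ Nat.primesLE y, Real.log p ^ 2 * ((p : ℝ) ^ σ / ((p : ℝ) ^ σ - 1) ^ 2) ≤
      1 / 50 * ∑ p ∈ Nat.primesLE y,
        2 * (p : ℝ) ^ (-σ) * (1 - Real.cos (t * Real.log p)) / (1 - (p : ℝ) ^ (-σ)) ^ 2 := by
    rw [Finset.mul_sum, Finset.mul_sum]
    refine Finset.sum_le_sum fun p hp => ?_
    obtain ⟨hpy, hpp⟩ := Nat.mem_primesLE.1 hp
    have hp2 := hpp.two_le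
    have hp1r : (1 : ℝ) < p := by exact_mod_cast (lt_of_lt_of_le one_lt_two hp2)
    have hp0r : (0 : ℝ) < p := by linarith
    have hlogp0 : 0 ≤ Real.log p := Real.log_nonneg hp1r.le
    have hlogp : Real.log p ≤ Real.log y := Real.log_le_log hp0r (by exact_mod_cast hpy)
    -- `|t log p| ≤ π`
    have hφ : |t * Real.log p| ≤ Real.pi := by
      rw [abs_mul, abs_of_nonneg hlogp0]
      exact le_trans (mul_le_mul_of_nonneg_left hlogp (abs_nonneg t)) ht
    have hcos := two_div_pi_sq_mul_sq_le_one_sub_cos hφ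
    -- `p^{-σ}/(1 - p^{-σ})² = p^σ/(p^σ - 1)²`
    have hP1 : 1 < (p : ℝ) ^ σ := Real.one_lt_rpow hp1r hσ0
    have hinv : (p : ℝ) ^ (-σ) = ((p : ℝ) ^ σ)⁻¹ := Real.rpow_neg hp0r.le σ
    have hratio : (p : ℝ) ^ (-σ) / (1 - (p : ℝ) ^ (-σ)) ^ 2 =
        (p : ℝ) ^ σ / ((p : ℝ) ^ σ - 1) ^ 2 := by
      rw [hinv]
      have hP0 : (p : ℝ) ^ σ ≠ 0 := by positivity
      have hP1' : (p : ℝ) ^ σ - 1 ≠ 0 := by linarith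
      field_simp
    have hw0 : 0 ≤ (p : ℝ) ^ (-σ) / (1 - (p : ℝ) ^ (-σ)) ^ 2 := by rw [hratio]; positivity
    calc 2 / (25 * Real.pi ^ 2) * t ^ 2 * (Real.log p ^ 2 * ((p : ℝ) ^ σ / ((p : ℝ) ^ σ - 1) ^ 2))
        = 1 / 50 * ((2 / Real.pi ^ 2 * (t * Real.log p) ^ 2) * (2 * ((p : ℝ) ^ (-σ) /
            (1 - (p : ℝ) ^ (-σ)) ^ 2))) := by rw [hratio]; ring
      _ ≤ 1 / 50 * ((1 - Real.cos (t * Real.log p)) * (2 * ((p : ℝ) ^ (-σ) /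
            (1 - (p : ℝ) ^ (-σ)) ^ 2))) := by
          refine mul_le_mul_of_nonneg_left (mul_le_mul_of_nonneg_right hcos (by positivity)) ?_
          norm_num
      _ = 1 / 50 * (2 * (p : ℝ) ^ (-σ) * (1 - Real.cos (t * Real.log p)) /
            (1 - (p : ℝ) ^ (-σ)) ^ 2) := by ring
  linarith


/-! ### `ζ(s, y)` as the Dirichlet series of the `y`-smooth numbers -/

/-- The indicator of the `y`-smooth numbers (`n ≥ 1` with all prime factors `≤ y`, i.e. Mathlib's
`Nat.smoothNumbers (y + 1)`), as complex Dirichlet coefficients. [folklore] -/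
def smoothIndicator (y : ℕ) : ℕ → ℂ :=
  (Nat.smoothNumbers (y + 1)).indicator 1

/-- Unfolding lemma for `smoothIndicator`. [folklore] -/
theorem smoothIndicator_apply (y n : ℕ) :
    smoothIndicator y n = (Nat.smoothNumbers (y + 1)).indicator 1 n := rfl

/-- `smoothIndicator y 0 = 0`. [folklore] -/
theorem smoothIndicator_zero (y : ℕ) : smoothIndicator y 0 = 0 := by
  rw [smoothIndicator, Set.indicator_of_notMem]
  exact fun h => (Nat.ne_zero_of_mem_smoothNumbers h) rfl

/-- The terms of `L(1_{S(y)}, s)` are `n^{-s}` on the `y`-smooth `n` and `0` elsewhere. [folklore] -/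
theorem term_smoothIndicator (y : ℕ) (s : ℂ) (n : ℕ) :
    LSeries.term (smoothIndicator y) s n =
      (Nat.smoothNumbers (y + 1)).indicator (fun m : ℕ => (m : ℂ) ^ (-s)) n := by
  rcases eq_or_ne n 0 with rfl | hn
  · rw [LSeries.term_zero, Set.indicator_of_notMem]
    exact fun h => (Nat.ne_zero_of_mem_smoothNumbers h) rfl
  · rw [LSeries.term_of_ne_zero hn, smoothIndicator]
    by_cases hmem : n ∈ Nat.smoothNumbers (y + 1)
    · rw [Set.indicator_of_mem hmem, Set.indicator_of_mem hmem, Pi.one_apply, cpow_neg, one_div]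
    · rw [Set.indicator_of_notMem hmem, Set.indicator_of_notMem hmem, zero_div]

/-- **`ζ(s, y) = Σ_{n y-smooth} n^{-s}` for `Re s > 0`** (absolutely convergent; Mathlib's Euler product
over the smooth numbers, `EulerProduct.summable_and_hasSum_smoothNumbers_prod_primesBelow_geometric`).
[cite: HildebrandTenenbaum1986, §2 (definition of ζ(s, y)); Harper2016, §2.1 (Smooth Numbers Result 1)] -/
theorem LSeriesHasSum_smoothIndicator (hs : 0 < s.re) (y : ℕ) :
    LSeriesHasSum (smoothIndicator y) s (smoothZetaC s y) := by
  have hs0 : s ≠ 0 := fun h => by rw [h] at hs; simp at hs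
  set f : ℕ →* ℂ := (riemannZetaSummandHom hs0).toMonoidHom with hf
  have hfp : ∀ n : ℕ, f n = (n : ℂ) ^ (-s) := fun n => rfl
  have hlt : ∀ {p : ℕ}, p.Prime → ‖f p‖ < 1 := by
    intro p hp
    rw [hfp, norm_natCast_cpow_neg hp.pos]
    have hp1 : (1 : ℝ) < p := by exact_mod_cast hp.one_lt
    exact Real.rpow_lt_one_of_one_lt_of_neg hp1 (by linarith)
  have h := (EulerProduct.summable_and_hasSum_smoothNumbers_prod_primesBelow_geometric hlt (y + 1)).2
  rw [LSeriesHasSum, show LSeries.term (smoothIndicator y) s =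
    (Nat.smoothNumbers (y + 1)).indicator (fun m : ℕ => (m : ℂ) ^ (-s)) from
      funext (term_smoothIndicator y s), ← hasSum_subtype_iff_indicator]
  have heq : smoothZetaC s y = ∏ p ∈ (y + 1).primesBelow, (1 - f p)⁻¹ := by
    rw [smoothZetaC, Nat.primesLE]
    simp only [hfp]
  rw [heq]
  exact h

/-- `L(1_{S(y)}, s)` converges absolutely for `Re s > 0`. [folklore] -/
theorem LSeriesSummable_smoothIndicator (hs : 0 < s.re) (y : ℕ) :
    LSeriesSummable (smoothIndicator y) s :=
  (LSeriesHasSum_smoothIndicator hs y).LSeriesSummable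

/-- `L(1_{S(y)}, s) = ζ(s, y)` for `Re s > 0`. [cite: HildebrandTenenbaum1986, §2 (definition of ζ(s, y))] -/
theorem LSeries_smoothIndicator (hs : 0 < s.re) (y : ℕ) :
    LSeries (smoothIndicator y) s = smoothZetaC s y :=
  (LSeriesHasSum_smoothIndicator hs y).LSeries_eq

end Literature.NumberTheory.Sieve

end
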